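import Literature.Barriers.Parity.FordFixedLevelProofs
import HarnessLib

/-!
# `FordFixedLevel` — the barrier in the strength of the printed construction (pointwise, bounded)

Topic `Literature/Barriers/Parity`, second companion of the catalogue entry `FordFixedLevel.lean`
(Ford's fixed-level barrier for Bombieri's asymptotic sieve, D-0021). Outcome of the barrier audit
of 2026-08-16: the catalogue fact `FordFixedLevelBarrier` ([Ford2004] Theorem 1, first assertion) is
a theorem of the tree (`FordFixedLevelBarrier_holds`), but it transcribes LESS than the printed
construction delivers, and the omitted clauses are exactly the crude side hypotheses that
fixed-level variants of Bombieri's theorem carry — so that, as catalogued, the barrier does not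
formally refute them:

* (2.3) `0 ≤ a_n ≤ 2` ([Ford2004] §2), whence every crude size hypothesis of the asymptotic sieve
  (second moments `∑ a_n² ≪ x (log x)^C` as in `Literature.NumberTheory.Sieve.bombieri_asymptotic_sieve`,
  Bombieri's individual bound (A₃) `|R(x; d)| ≪ A(x)/d` for ALL `d < x`, divisor-boundedness);
* the POINTWISE remainder bound `A_d(x) = x/d + O((x/d) e^{−(c₁/2)√log x})` for every `d ≤ x^ν`
  ([Ford2004] §2, p. 5, the display preceding "Summing on `d` gives `R(ν)`"), whence the level
  hypothesis in Bombieri's `sup_{y ≤ x}` form (A₂) at any exponent below `ν`, not only the `ℓ¹`-form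
  `R(ν)` at `y = x`.

Both are established inside the tree's proof (`Ford2004.glue_bounds`, `Ford2004.typeI_pointwise` in
`FordFixedLevelProofs.lean`) but are invisible in the statement of `FordFixedLevelBarrier`. This file
re-runs the assembly of [Ford2004] §2, p. 5 keeping them, for ONE witness sequence per `ν`:

* `fordFixedLevel_pointwise_of_localConstruction` — from the local construction
  `Literature.NumberTheory.Sieve.Ford2004_localConstruction` ([Ford2004] Theorem 3 with the `f_{1_M}`
  of the proof of Theorem 1): for every `ν ∈ (0,1)` a sequence with `0 ≤ a_n ≤ 2`, the pointwise
  bound `|A_d(x) − x/d| ≤ x (log x)^{−B}/d` for all `1 ≤ d ≤ x^ν`, all real `B` and all large `x`,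
  the `ℓ¹` bound `R(ν)`, and the failure of `(S_k)` for every `k ≥ 1`;
* `fordFixedLevel_pointwise` — the unconditional statement, through the tree's
  `Literature.NumberTheory.Sieve.Ford2004_localConstruction_holds`;
* the catalogue fact `FordFixedLevelBarrier` is the special case forgetting the two extra clauses
  (take `⟨a, fun n => (h02 n).1, hR, hS⟩`), so nothing here is weaker than the catalogue entry; it is
  not re-proved here (`FordFixedLevelBarrier_holds` exists).

No definitions, no named facts: every declaration is a theorem. The analytic inputs are those of
`FordFixedLevelProofs.lean` (prime number theorem with the de la Vallée Poussin error term,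
`∑_{n ≤ x} Λ_k(n) = k x (log x)^{k−1} + O(x (log x)^{k−2})`), all proved in the tree.

## References

* K. Ford, *On Bombieri's asymptotic sieve*, Trans. Amer. Math. Soc. 357 (2005), 1663–1674
  (arXiv math/0401215), Theorem 1, §2 (2.3)–(2.5) and p. 5 [Ford2004] (read, arXiv pp. 3–5, 7–9).
* J. Friedlander, H. Iwaniec, *On Bombieri's asymptotic sieve*, Ann. Scuola Norm. Sup. Pisa (4) 5
  (1978), 719–756, p. 719 (A₂) with `θ₀ ≤ 1` and `sup_{y ≤ x}`, p. 720 (A₃) [FriedlanderIwaniecPisa1978].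
-/

noncomputable section

open Filter Asymptotics Finset Real Topology
open Literature.NumberTheory.Sieve Literature.NumberTheory.LFunctions

namespace Literature.Barriers.Parity

/-- **Ford's Theorem 1 with the printed side information** ([Ford2004] Theorem 1 and §2, p. 5,
from the local construction, Theorem 3): for every `ν ∈ (0, 1)` there is ONE sequence `(a_n)` with
(i) `0 ≤ a_n ≤ 2` ((2.3)); (ii) the pointwise Type-I bound: for every real `B`, for all large `x`
and every `1 ≤ d ≤ x^ν`, `|A_d(x) − x/d| ≤ x (log x)^{−B} / d` (p. 5: `A_d(x) = x/d +
O((x/d)e^{−(c₁/2)√log x})`, the de la Vallée Poussin factor beating every power of `log`);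
(iii) `R(ν)`: `∑_{d ≤ x^ν} |A_d(x) − x/d| ≪_B x (log x)^{−B}` for every `B > 0`; (iv) `(S_k)` fails for
every `k ≥ 1`: `¬ (∑_{n ≤ x} a_n Λ_k(n) ∼ k x (log x)^{k−1})`. The witness is the glued sequence of
`FordFixedLevelBarrier_of_localConstruction` (sign `σ_j = +1`, case (ii) of Theorem 1); (ii) is
`Ford2004.typeI_pointwise` with the absorptions `Ford2004.eventually_rpow_absorb`,
`Ford2004.eventually_eta_absorb`, `Ford2004.eventually_const_absorb` at exponent `B + 1` and
`log x ≥ 4`; (i) is `Ford2004.glue_bounds`; (iii), (iv) verbatim as in the catalogue proof.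
[cite: Ford2004, Theorem 1; §2 (2.3) and p. 5] -/
theorem fordFixedLevel_pointwise_of_localConstruction (hF : Ford2004_localConstruction) :
    ∀ ν : ℝ, 0 < ν → ν < 1 →
      ∃ a : ℕ → ℝ, (∀ n, 0 ≤ a n ∧ a n ≤ 2) ∧
        (∀ B : ℝ, ∀ᶠ x : ℝ in atTop, ∀ d : ℕ, 1 ≤ d → (d : ℝ) ≤ x ^ ν →
          |(∑ n ∈ (Ioc 0 ⌊x⌋₊).filter (d ∣ ·), a n) - x / d| ≤ x / Real.log x ^ B / d) ∧
        (∀ B : ℝ, 0 < B →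
          (fun x : ℝ => ∑ d ∈ Icc 1 ⌊x ^ ν⌋₊,
              |(∑ n ∈ (Ioc 0 ⌊x⌋₊).filter (d ∣ ·), a n) - x / d|) =O[atTop]
            fun x : ℝ => x / Real.log x ^ B) ∧
        ∀ k : ℕ, 1 ≤ k →
          ¬ ((fun x : ℝ => ∑ n ∈ Ioc 0 ⌊x⌋₊, a n * generalizedVonMangoldt k n) ~[atTop]
              fun x : ℝ => (k : ℝ) * x * Real.log x ^ (k - 1)) := by
  intro ν hν0 hν1
  obtain ⟨ϖ, hϖ0, hϖ1, c₁, hc₁, θ, hθ, C, Ck, xk, x₀, hloc⟩ := hF ν hν0 hν1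
  -- the end-points `x_j`, started at `X₀ = max x₀ 2`
  have hX : (2 : ℝ) ≤ max x₀ 2 := le_max_right _ _
  have hX0 : (0 : ℝ) < max x₀ 2 := by linarith
  obtain ⟨xs, h0, hrec⟩ : ∃ xs : ℕ → ℝ, xs 0 = max x₀ 2 ∧
      ∀ j, xs (j + 1) = xs j + xs j * Ford2004.eta c₁ (xs j) :=
    ⟨fun j => Nat.rec (max x₀ 2) (fun _ x => x + x * Ford2004.eta c₁ x) j, rfl, fun _ => rfl⟩
  have hxs0 : ∀ j, x₀ ≤ xs j := by
    intro j
    have h1 := Ford2004.xs_mono hX0 h0 hrec (Nat.zero_le j)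
    rw [h0] at h1
    exact le_trans (le_max_left _ _) h1
  -- the local data on each interval, with the sign `σ_j = 1`
  choose aloc haloc using fun j => hloc (xs j) (hxs0 j) 1 (Or.inl rfl)
  -- the glued sequence
  have hNmono : Monotone fun j => ⌊xs j⌋₊ := fun i j hij =>
    Nat.floor_le_floor (Ford2004.xs_mono hX0 h0 hrec hij)
  obtain ⟨a, ha, ha1⟩ := Ford2004.exists_glue hNmono aloc
  have h23 : ∀ j n, 0 ≤ aloc j n ∧ aloc j n ≤ 2 := fun j n => (haloc j).1 n
  have h02 : ∀ n, 0 ≤ a n ∧ a n ≤ 2 := Ford2004.glue_bounds h23 ha ha1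
  -- (2.4) on every interval, with the non-negative constant `max C 0`
  have h24 : ∀ j (d : ℕ), 1 ≤ d → (d : ℝ) ≤ xs j ^ (1 - ϖ) →
      |(∑ n ∈ (Ioc ⌊xs j⌋₊ ⌊xs (j + 1)⌋₊).filter (d ∣ ·), aloc j n)
          - ((Ioc ⌊xs j⌋₊ ⌊xs (j + 1)⌋₊).card : ℝ) / d|
        ≤ max C 0 * (((Ioc ⌊xs j⌋₊ ⌊xs (j + 1)⌋₊).card : ℝ) / d * Ford2004.eta c₁ (xs j)) := by
    intro j d hd1 hd2
    have h := (haloc j).2.1 d hd1 hd2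
    rw [← hrec j] at h
    refine h.trans ?_
    rw [mul_assoc]
    refine mul_le_mul_of_nonneg_right (le_max_left _ _) ?_
    exact mul_nonneg (div_nonneg (Nat.cast_nonneg _) (Nat.cast_nonneg _))
      (Ford2004.eta_pos _ _).le
  refine ⟨a, h02, ?_, ?_, ?_⟩
  · -- (ii) the pointwise Type-I bound
    intro B
    have hνϖ0 : 0 < ν + ϖ := by linarith
    have hνϖ1 : ν + ϖ < 1 := by linarith
    have hc2 : 0 < c₁ * Real.sqrt (ν + ϖ) := mul_pos hc₁ (Real.sqrt_pos.mpr hνϖ0)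
    have hc3 : 0 < c₁ * Real.sqrt (1 / 2) := mul_pos hc₁ (Real.sqrt_pos.mpr (by norm_num))
    filter_upwards [eventually_ge_atTop (max (max x₀ 2) 4),
      (tendsto_rpow_atTop hνϖ0).eventually_ge_atTop (max x₀ 2),
      Ford2004.eventually_rpow_absorb hνϖ1 0 2,
      Ford2004.eventually_rpow_absorb hνϖ1 (B + 1) 4,
      Ford2004.eventually_eta_absorb hc2 (B + 1) (max C 0),
      Ford2004.eventually_eta_absorb hc3 (B + 1) (1 + max C 0),
      Ford2004.eventually_const_absorb (B + 1) (1 + max C 0),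
      Real.tendsto_log_atTop.eventually_ge_atTop (4 : ℝ)]
      with x hx hxpow hx2 hE1 hE2 hE3 hE4 hL4
    intro d hd1 hdx
    have hxX : max x₀ 2 ≤ x := le_trans (le_max_left _ _) hx
    have hx4 : 4 ≤ x := le_trans (le_max_right _ _) hx
    have hx0 : 0 < x := by linarith
    have hx1 : 1 < x := by linarith
    have hL0 : 0 < Real.log x := Real.log_pos hx1
    have hLB : 0 < Real.log x ^ B := Real.rpow_pos_of_pos hL0 B
    have hd0 : (0 : ℝ) < d := by exact_mod_cast hd1
    have hxνϖ : 0 ≤ x ^ (ν + ϖ) := Real.rpow_nonneg hx0.le _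
    have hxlow : max x₀ 2 ≤ 2 * x ^ (ν + ϖ) := by linarith
    have hxup : 2 * x ^ (ν + ϖ) ≤ x := by
      rw [Real.rpow_zero, div_one] at hx2
      have h1 : 2 * x ^ (ν + ϖ) ≤ 2 * x ^ (ν + ϖ) * (1 + Real.log x) :=
        le_mul_of_one_le_right (by positivity) (by linarith)
      linarith
    have hpt := Ford2004.typeI_pointwise hν0 hϖ0 hϖ1 hc₁ (le_max_right C 0) hX h0 hrec h02 ha h24
      hxX hx4 hxlow hxup hd1 hdx
    have hη0 : 0 ≤ Ford2004.eta c₁ (x ^ (ν + ϖ)) := (Ford2004.eta_pos _ _).le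
    have hη0' : 0 ≤ Ford2004.eta (c₁ * Real.sqrt (1 / 2)) x := (Ford2004.eta_pos _ _).le
    have hC0 : 0 ≤ max C 0 := le_max_right _ _
    set E := 4 * x ^ (ν + ϖ) + max C 0 * (x * Ford2004.eta c₁ (x ^ (ν + ϖ)))
      + (1 + max C 0) * (x * Ford2004.eta (c₁ * Real.sqrt (1 / 2)) x + 1) with hE
    have hE0 : 0 ≤ E := by positivity
    have hη1 : Ford2004.eta c₁ (x ^ (ν + ϖ)) = Ford2004.eta (c₁ * Real.sqrt (ν + ϖ)) x :=
      Ford2004.eta_rpow hνϖ0.le hx0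
    -- `E (1 + log x) ≤ 4 x/(log x)^{B+1}`
    have hEexp : E * (1 + Real.log x) = 4 * x ^ (ν + ϖ) * (1 + Real.log x)
        + max C 0 * (x * Ford2004.eta (c₁ * Real.sqrt (ν + ϖ)) x) * (1 + Real.log x)
        + (1 + max C 0) * (x * Ford2004.eta (c₁ * Real.sqrt (1 / 2)) x) * (1 + Real.log x)
        + (1 + max C 0) * (1 + Real.log x) := by
      rw [hE, hη1]; ring
    have hE1' : E * (1 + Real.log x) ≤ 4 * (x / Real.log x ^ (B + 1)) := by
      rw [hEexp]; linarith
    -- `E ≤ E (1 + log x)` and `4 x/(log x)^{B+1} ≤ x/(log x)^B` since `log x ≥ 4`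
    have hE2' : E ≤ E * (1 + Real.log x) := le_mul_of_one_le_right hE0 (by linarith)
    have hsplit : Real.log x ^ (B + 1) = Real.log x ^ B * Real.log x := by
      rw [Real.rpow_add hL0, Real.rpow_one]
    have hE3' : 4 * (x / Real.log x ^ (B + 1)) ≤ x / Real.log x ^ B := by
      rw [hsplit, div_mul_eq_div_div]
      rw [show 4 * (x / Real.log x ^ B / Real.log x) = (x / Real.log x ^ B) * (4 / Real.log x) by ring]
      refine mul_le_of_le_one_right (by positivity) ?_
      rw [div_le_one hL0]
      exact hL4
    have hEfin : E ≤ x / Real.log x ^ B := hE2'.trans (hE1'.trans hE3')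
    calc |(∑ n ∈ (Ioc 0 ⌊x⌋₊).filter (d ∣ ·), a n) - x / d| ≤ E / d := hpt
      _ ≤ x / Real.log x ^ B / d := div_le_div_of_nonneg_right hEfin hd0.le
  · -- (iii) `R(ν)`
    intro B _hB
    exact Ford2004.typeI_isBigO hν0 hν1 hϖ0 hϖ1 hc₁ (le_max_right C 0) hX h0 hrec h02 ha h24 B
  · -- (iv) `(S_k)` fails for every `k ≥ 1`
    intro k hk
    obtain ⟨m, rfl⟩ : ∃ m, k = m + 1 := ⟨k - 1, by omega⟩
    simp only [Nat.add_sub_cancel]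
    have hpos := Ford2004.xs_pos hX0 h0 hrec
    have h25 : ∀ j, xk (m + 1) ≤ xs j →
        |(∑ n ∈ Ioc ⌊xs j⌋₊ ⌊xs (j + 1)⌋₊, (aloc j n - 1) * generalizedVonMangoldt (m + 1) n)
            - θ (m + 1) * ((Ioc ⌊xs j⌋₊ ⌊xs (j + 1)⌋₊).card : ℝ) * Real.log (xs j) ^ m|
          ≤ max (Ck (m + 1)) 0 * ((Ioc ⌊xs j⌋₊ ⌊xs (j + 1)⌋₊).card : ℝ) * Real.log (xs j) ^ m
            * Ford2004.eta c₁ (xs j) := by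
      intro j hj
      have h := (haloc j).2.2 (m + 1) (by omega) hj
      rw [← hrec j] at h
      simp only [Nat.add_sub_cancel, one_mul] at h
      refine h.trans ?_
      have hL : 0 ≤ Real.log (xs j) := by
        refine Real.log_nonneg ?_
        have h1 := Ford2004.xs_mono hX0 h0 hrec (Nat.zero_le j)
        rw [h0] at h1
        linarith
      have h2 : 0 ≤ ((Ioc ⌊xs j⌋₊ ⌊xs (j + 1)⌋₊).card : ℝ) * Real.log (xs j) ^ m
          * Ford2004.eta c₁ (xs j) :=
        mul_nonneg (mul_nonneg (Nat.cast_nonneg _) (pow_nonneg hL m)) (Ford2004.eta_pos _ _).le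
      calc Ck (m + 1) * ((Ioc ⌊xs j⌋₊ ⌊xs (j + 1)⌋₊).card : ℝ) * Real.log (xs j) ^ m
            * Ford2004.eta c₁ (xs j)
          = Ck (m + 1) * (((Ioc ⌊xs j⌋₊ ⌊xs (j + 1)⌋₊).card : ℝ) * Real.log (xs j) ^ m
            * Ford2004.eta c₁ (xs j)) := by ring
        _ ≤ max (Ck (m + 1)) 0 * (((Ioc ⌊xs j⌋₊ ⌊xs (j + 1)⌋₊).card : ℝ) * Real.log (xs j) ^ m
            * Ford2004.eta c₁ (xs j)) := mul_le_mul_of_nonneg_right (le_max_left _ _) h2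
        _ = _ := by ring
    exact Ford2004.not_isEquivalent_of_local hc₁ hX h0 hrec h02 ha (hθ (m + 1) (by omega))
      (le_max_right _ 0) h25

/-- **Ford's fixed-level barrier, pointwise and bounded form, unconditionally** ([Ford2004]
Theorem 1 with (2.3) and the pointwise remainder bound of §2, p. 5): for every `ν ∈ (0,1)` one
sequence with `0 ≤ a_n ≤ 2`, `|A_d(x) − x/d| ≤ x (log x)^{−B}/d` for all `1 ≤ d ≤ x^ν` and all
large `x` (every real `B`), `R(ν)`, and `(S_k)` failing for every `k ≥ 1`. From
`fordFixedLevel_pointwise_of_localConstruction` and the tree's theorem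
`Literature.NumberTheory.Sieve.Ford2004_localConstruction_holds`. Use: the witness meets every crude
size hypothesis of the asymptotic sieve (second moments, Bombieri's (A₃) for all `d < x`, bounded
terms) and the `sup_{y ≤ x}` level hypothesis (A₂) at any exponent `< ν`, so fixed-level variants
of `Literature.NumberTheory.Sieve.bombieri_asymptotic_sieve` / `Bombieri1976_asymptotic_sieve` are
refuted by THIS statement, not by the catalogue entry alone. [cite: Ford2004, Theorem 1; §2 (2.3) and p. 5] -/
theorem fordFixedLevel_pointwise :
    ∀ ν : ℝ, 0 < ν → ν < 1 →
      ∃ a : ℕ → ℝ, (∀ n, 0 ≤ a n ∧ a n ≤ 2) ∧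
        (∀ B : ℝ, ∀ᶠ x : ℝ in atTop, ∀ d : ℕ, 1 ≤ d → (d : ℝ) ≤ x ^ ν →
          |(∑ n ∈ (Ioc 0 ⌊x⌋₊).filter (d ∣ ·), a n) - x / d| ≤ x / Real.log x ^ B / d) ∧
        (∀ B : ℝ, 0 < B →
          (fun x : ℝ => ∑ d ∈ Icc 1 ⌊x ^ ν⌋₊,
              |(∑ n ∈ (Ioc 0 ⌊x⌋₊).filter (d ∣ ·), a n) - x / d|) =O[atTop]
            fun x : ℝ => x / Real.log x ^ B) ∧
        ∀ k : ℕ, 1 ≤ k →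
          ¬ ((fun x : ℝ => ∑ n ∈ Ioc 0 ⌊x⌋₊, a n * generalizedVonMangoldt k n) ~[atTop]
              fun x : ℝ => (k : ℝ) * x * Real.log x ^ (k - 1)) :=
  fordFixedLevel_pointwise_of_localConstruction
    Literature.NumberTheory.Sieve.Ford2004_localConstruction_holds

end Literature.Barriers.Parity

end
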